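import Literature.Geometry.Kaehler.ComplexTorusWeilRational
import Mathlib.LinearAlgebra.Matrix.NonsingularInverse
import HarnessLib

/-!
# The explicit complex torus of Weil type is simple

C. Voisin, *A counterexample to the Hodge conjecture extended to Kähler varieties*, IMRN 2002
no. 20, §3 Prop. 3: "For a general `X` as above, we have: (i) `NS(X) = 0`. (ii) `X` is simple.
(iii) …", and §3, p. 5: "Since `X` is a complex torus, assumption (b) [no proper positive-dimensional
analytic subset] will be a consequence of assumption (a) [`NS(X) = 0`] and of the fact that `X` is
simple" (via Ueno's structure theory of subvarieties of complex tori, LNM 439, Thm. 10.9 and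
Lemma 10.8). This file PROVES (ii) for the one explicit very general torus of Weil type
`X = ℂ⁴/Φ(ℤ⁸)`, `Φ = Weil.periodEquiv` of `ComplexTorusWeilPeriod.lean` (transcendental period `t`),
for which (i) is `ComplexTorusWeilNeronSeveri.lean`:

* **`Weil.eq_bot_or_eq_top_of_cs_stable`**: a real subspace `V ⊆ Γ_ℝ = ℝ⁸` spanned by rational
  (lattice) vectors — so that `V/(V ∩ Γ)` is a real subtorus of `X` — and stable under the complex
  structure `I_t = Φ⁻¹ ∘ i ∘ Φ` — so that the subtorus is a complex subtorus — is `0` or `Γ_ℝ`: **`X`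
  has no complex subtorus other than `0` and `X`.**

## Proof ("general" replaced by the transcendence of `t`)

With `A = I` the `ℤ[I]`-structure (`Φ ∘ A = J ∘ Φ`, so `A` commutes with `I_t`), `V ∩ A V` and
`V + A V` are rational, `I_t`-stable and `A`-stable.
* Case 1 (`not_stable_of_rotLin_stable`): an `A`-stable, `I_t`-stable, rational `U` with
  `0 ≠ U ≠ Γ_ℝ` is impossible. In the coordinates `ζ` (`ComplexTorusWeilStructure.lean`) `U` becomes a
  complex subspace `S = ζ(U) ⊆ ℂ⁴` of dimension `d ∈ {1, 2, 3}` stable under `π_Q`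
  (`I_t = i(π_Q - π_P)`), containing a non-zero Gaussian-rational vector `u` and contained in the
  kernel of a non-zero Gaussian-rational covector `c` (from a rational vector orthogonal to `U` and
  to `A U`; rational kernel vectors exist by base change, `ComplexTorusWeilRational.lean`).
  `d = 1`: `π_Q u ∈ ℂ u` forces `u ∈ N_P ∪ N_Q`, excluded by (T1). `d = 3`: `S = ker c` and the
  idempotent induced by `π_Q` on `ℂ⁴/S ≅ ℂ` is `0` or `1`, so `c` kills `N_Q` or `N_P`: (T2).
  `d = 2`: a second covector `c' ⊥ c`, `S = ker (c, c')`, and the idempotent `e` induced on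
  `ℂ⁴/S ≅ ℂ²` satisfies `e D = D` for the matrix `D` of `(c, c')` on `(h₁, h₂)`; either `det D = 0` —
  then all minors of `(c, c')` vanish by (T3) and `c' ∥ c`, absurd — or `det e = 1`, `e = 1`, and `c`
  kills `N_P`: (T2).
* Case 2 (`not_isCompl_map_rotLin`): `Γ_ℝ = V ⊕ A V` is impossible: the projection `π` onto `V`
  is rational and commutes with `I_t`, and `π - ½` anticommutes with `A`, so `π = ½` by Part B of
  `End_ℚ(X) = ℚ(i)` (`eq_zero_of_anticommute`), which is not idempotent.

No definition and no named fact is introduced. (On the remark "a rational subspace stable under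
`I_t` would be stable under `I_{t'}` for all admissible rational `t'`" of the assembly file
`Literature/Barriers/HodgeConjecture/KaehlerCoherentSheavesAssemblyProofs.lean`: the present proof
replaces that specialisation argument by the direct transcendence statements (T1)–(T4).)

## References

* C. Voisin, *A counterexample to the Hodge conjecture extended to Kähler varieties*, IMRN 2002
  no. 20, 1057–1075 (arXiv:math/0112247), §3 p. 5 (the torus of Weil type, `W = W_i ⊕ W_{-i}`,
  `W ∩ Γ_ℝ = {0}`) and Prop. 3 (ii) ("`X` is simple" for the general member).
  [Voisin2002KaehlerCounterexample]
* Ch. Birkenhake, H. Lange, *Complex Abelian Varieties* (1992), §1.1–1.2 (period matrices, complex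
  subtori and rational complex subspaces). [LangeBirkenhake1992]
* K. Ueno, *Classification Theory of Algebraic Varieties and Compact Complex Spaces*, LNM 439
  (1975), §10, Lemma 10.8 and Thm. 10.9 (the use of simplicity in Voisin's §3). [Ueno1975]
-/

noncomputable section

open scoped ComplexConjugate Matrix
open Polynomial Module

namespace Literature.Geometry.Kaehler

namespace Weil

/-! ### Auxiliary statements -/

/-- `c̄ · c ≠ 0` for `c ≠ 0` (the Hermitian square norm). [folklore] -/
theorem star_dotProduct_self_ne_zero {c : Fin 4 → ℂ} (hc : c ≠ 0) : star c ⬝ᵥ c ≠ 0 := by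
  open scoped ComplexOrder in
  exact fun h ↦ hc (dotProduct_star_self_eq_zero.1 h)

/-- The image under `A` of the real span of a rational family. [folklore] -/
theorem map_rotLin_span {ι : Type*} (r : ι → Fin 8 → ℚ) :
    (Submodule.span ℝ (Set.range fun i ↦ ratVec (r i))).map rotLin =
      Submodule.span ℝ (Set.range fun i ↦ ratVec (rotQ (r i))) := by
  rw [Submodule.map_span]
  congr 1
  ext x
  simp only [Set.mem_image, Set.mem_range]
  constructor
  · rintro ⟨_, ⟨i, rfl⟩, rfl⟩
    exact ⟨i, by rw [ratVec_rotQ]⟩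
  · rintro ⟨i, rfl⟩
    exact ⟨ratVec (r i), ⟨i, rfl⟩, (ratVec_rotQ (r i)).symm⟩

/-- A real subspace spanned by rational vectors annihilated by a rational covector. [folklore] -/
theorem dotProduct_eq_zero_of_mem_span {ι : Type*} (r : ι → Fin 8 → ℚ) {y : Fin 8 → ℚ}
    (hy : ∀ i, r i ⬝ᵥ y = 0) {U : Submodule ℝ (Fin 8 → ℝ)}
    (hU : U = Submodule.span ℝ (Set.range fun i ↦ ratVec (r i))) {x : Fin 8 → ℝ} (hx : x ∈ U) :
    x ⬝ᵥ ratVec y = 0 := by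
  have hle : U ≤ LinearMap.ker (dotR (ratVec y)) := by
    rw [hU, Submodule.span_le]
    rintro _ ⟨i, rfl⟩
    rw [SetLike.mem_coe, LinearMap.mem_ker, dotR_apply, ratVec_dotProduct, hy, Rat.cast_zero]
  exact hle hx

/-! ### Case 1: a proper non-zero rational subspace stable under `A` and `I_t` -/

/-- **Case 1 of the simplicity proof.** There is no real subspace `U` of `Γ_ℝ = ℝ⁸` spanned by
rational vectors, stable under `A = I` and under the complex structure `I_t`, with `0 ≠ U ≠ ℝ⁸`:
`ζ(U) ⊆ ℂ⁴` would be a `π_Q`-stable complex subspace of dimension `1, 2` or `3` with a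
Gaussian-rational vector inside and Gaussian-rational covectors `c` (and `c'`) vanishing on it, and
each of the three cases ends in one of the transcendence statements (T1)–(T3).
[cite: Voisin2002KaehlerCounterexample, §3 Prop. 3 (ii)] -/
theorem not_stable_of_rotLin_stable {ι : Type*} [Fintype ι] [DecidableEq ι] (r : ι → Fin 8 → ℚ)
    (U : Submodule ℝ (Fin 8 → ℝ)) (hU : U = Submodule.span ℝ (Set.range fun i ↦ ratVec (r i)))
    (hA : ∀ x ∈ U, rotLin x ∈ U) (hcs : ∀ x ∈ U, cs x ∈ U) (h0 : U ≠ ⊥) (h1 : U ≠ ⊤) : False := by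
  classical
  set S := cx U hA with hS
  have hSQ : ∀ u ∈ S, projQ u ∈ S := fun u hu ↦ projQ_mem_cx hcs hu
  have hdim : finrank ℝ U = 2 * finrank ℂ S := finrank_eq_two_mul_finrank_cx U hA
  have hUpos : 0 < finrank ℝ U := by
    rw [pos_iff_ne_zero, Ne, Submodule.finrank_eq_zero]; exact h0
  have hUlt : finrank ℝ U < 8 := by simpa using Submodule.finrank_lt h1
  -- (i) a non-zero rational vector in `U`
  obtain ⟨i₀, hi₀⟩ : ∃ i, r i ≠ 0 := by
    by_contra h
    simp only [not_exists, not_not] at h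
    apply h0
    rw [hU, Submodule.span_eq_bot]
    rintro _ ⟨i, rfl⟩
    change ratVec (r i) = 0
    rw [h i]; exact ratVec_eq_zero_iff.2 rfl
  set s := r i₀ with hs
  have hsU : ratVec s ∈ U := by rw [hU]; exact Submodule.subset_span ⟨i₀, rfl⟩
  set a₀ : Fin 4 → ℚ := ![s 0, s 2, s 4, s 6] with ha₀
  set b₀ : Fin 4 → ℚ := ![s 1, s 3, s 5, s 7] with hb₀
  have hu : zetaVec (ratVec s) = gaussVec a₀ b₀ := by
    funext m; fin_cases m <;> apply Complex.ext <;> simp [zetaVec, gaussVec, ha₀, hb₀]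
  have huS : gaussVec a₀ b₀ ∈ S := hu ▸ zetaVec_mem_cx hsU
  have hab₀ : ¬(a₀ = 0 ∧ b₀ = 0) := by
    rintro ⟨ha, hb⟩
    apply hi₀
    funext j
    fin_cases j
    · exact congrFun ha 0
    · exact congrFun hb 0
    · exact congrFun ha 1
    · exact congrFun hb 1
    · exact congrFun ha 2
    · exact congrFun hb 2
    · exact congrFun ha 3
    · exact congrFun hb 3
  have hu0 : gaussVec a₀ b₀ ≠ 0 := fun h ↦ hab₀ ((gaussVec_eq_zero_iff a₀ b₀).1 h)
  -- (ii) a non-zero rational covector `y` vanishing on `U`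
  have hspanU : Submodule.span ℝ (Set.range fun i ↦ ratVec (Matrix.of r i)) = U := by rw [hU]; rfl
  obtain ⟨y, hy0, hy⟩ := exists_rat_mulVec_eq_zero (Matrix.of r) (by rw [hspanU]; exact hUlt)
  have hyr : ∀ i, r i ⬝ᵥ y = 0 := fun i ↦ congrFun hy i
  have hUy : ∀ x ∈ U, x ⬝ᵥ ratVec y = 0 := fun x hx ↦ dotProduct_eq_zero_of_mem_span r hyr hU hx
  have hUAy : ∀ x ∈ U, x ⬝ᵥ rotLin (ratVec y) = 0 := fun x hx ↦ by
    rw [dotProduct_rotLin, hUy _ (hA x hx), neg_zero]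
  set c := star (zetaVec (ratVec y)) with hcdef
  have hSc : ∀ v ∈ S, v ⬝ᵥ c = 0 := by
    rintro _ ⟨x, hx, rfl⟩
    rw [hcdef, zetaVec_dot_star, hUy x hx, hUAy x hx]; rfl
  set a₁ : Fin 4 → ℚ := ![y 0, y 2, y 4, y 6] with ha₁
  set b₁ : Fin 4 → ℚ := ![-y 1, -y 3, -y 5, -y 7] with hb₁
  have hc : c = gaussVec a₁ b₁ := by
    funext m; fin_cases m <;> apply Complex.ext <;> simp [hcdef, zetaVec, gaussVec, ha₁, hb₁]
  have hab₁ : ¬(a₁ = 0 ∧ b₁ = 0) := by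
    rintro ⟨ha, hb⟩
    apply hy0
    funext j
    fin_cases j
    · exact congrFun ha 0
    · have e := congrFun hb 0; rw [hb₁] at e; simpa using e
    · exact congrFun ha 1
    · have e := congrFun hb 1; rw [hb₁] at e; simpa using e
    · exact congrFun ha 2
    · have e := congrFun hb 2; rw [hb₁] at e; simpa using e
    · exact congrFun ha 3
    · have e := congrFun hb 3; rw [hb₁] at e; simpa using e
  have hc0 : c ≠ 0 := fun h ↦ hab₁ ((gaussVec_eq_zero_iff a₁ b₁).1 (hc ▸ h))
  -- the transcendence consequences in the form used below
  have T2a : ¬(h₁ ⬝ᵥ c = 0 ∧ h₂ ⬝ᵥ c = 0) := fun ⟨e1, e2⟩ ↦ hab₁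
    (gaussVec_eq_zero_of_dot_h a₁ b₁ (by rw [← hc, dotProduct_comm]; exact e1)
      (by rw [← hc, dotProduct_comm]; exact e2))
  have T2b : ¬(g₁ ⬝ᵥ c = 0 ∧ g₂ ⬝ᵥ c = 0) := fun ⟨e1, e2⟩ ↦ hab₁
    (gaussVec_eq_zero_of_dot_g a₁ b₁ (by rw [← hc, dotProduct_comm]; exact e1)
      (by rw [← hc, dotProduct_comm]; exact e2))
  -- case analysis on `d = dim_ℂ S ∈ {1, 2, 3}`
  have hd : finrank ℂ S = 1 ∨ finrank ℂ S = 2 ∨ finrank ℂ S = 3 := by omega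
  rcases hd with hd | hd | hd
  · /- d = 1 : `S = ℂ u`, so `π_Q u = l u` with `l ∈ {0, 1}`, i.e. `u ∈ N_P` or `u ∈ N_Q`: (T1). -/
    have huS0 : (⟨gaussVec a₀ b₀, huS⟩ : S) ≠ 0 := fun h ↦ hu0 (congrArg Subtype.val h)
    obtain ⟨l, hl⟩ := (finrank_eq_one_iff_of_nonzero' _ huS0).1 hd ⟨projQ (gaussVec a₀ b₀), hSQ _ huS⟩
    have hl' : l • gaussVec a₀ b₀ = projQ (gaussVec a₀ b₀) := congrArg Subtype.val hl
    have hll : (l * l - l) • gaussVec a₀ b₀ = 0 := by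
      have h2 : projQ (projQ (gaussVec a₀ b₀)) = projQ (gaussVec a₀ b₀) :=
        projQ_eq_self (projQ_mem _)
      rw [← hl', map_smul, ← hl', smul_smul] at h2
      rw [sub_smul]
      exact sub_eq_zero.2 h2
    rcases smul_eq_zero.1 hll with h | h
    · have h' : l * (l - 1) = 0 := by rw [mul_sub, mul_one]; exact h
      rcases mul_eq_zero.1 h' with h'' | h''
      · -- `l = 0`: `π_Q u = 0`, `u = π_P u ∈ N_P`
        rw [h'', zero_smul] at hl'
        have huP : gaussVec a₀ b₀ ∈ NP := by
          rw [← projQ_add_projP (gaussVec a₀ b₀), ← hl', zero_add]; exact projP_mem _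
        exact hab₀ (gaussVec_eq_zero_of_mem_NP a₀ b₀ huP)
      · -- `l = 1`: `π_Q u = u`, `u ∈ N_Q`
        rw [sub_eq_zero.1 h'', one_smul] at hl'
        have huQ : gaussVec a₀ b₀ ∈ NQ := by rw [hl']; exact projQ_mem _
        exact hab₀ (gaussVec_eq_zero_of_mem_NQ a₀ b₀ huQ)
    · exact hu0 h
  · /- d = 2 : a second rational covector `c'`, `S = ker (c, c')`, and the induced idempotent on
      `ℂ⁴/S ≅ ℂ²` has determinant `1` (then it is the identity and `c` kills `N_P`: (T2b)) or the
      `2 × 2` determinant on `h₁, h₂` vanishes (then `c' ∥ c` by (T3), contradicting `c' ⊥ c`). -/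
    have hU4 : finrank ℝ U = 4 := by omega
    -- the second covector
    let R' : Matrix (ι ⊕ Fin 2) (Fin 8) ℚ := Matrix.of (Sum.elim r ![y, rotQ y])
    have hR' : finrank ℝ (Submodule.span ℝ (Set.range fun i ↦ ratVec (R' i))) < 8 := by
      have e1 : (Set.range fun i ↦ ratVec (R' i)) =
          Set.range fun i ↦ ratVec (Sum.elim r ![y, rotQ y] i) := rfl
      rw [e1, span_ratVec_sum, ← hU]
      have h2 := Submodule.finrank_add_le_finrank_add_finrank U
        (Submodule.span ℝ (Set.range fun i ↦ ratVec (![y, rotQ y] i)))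
      have h3 : finrank ℝ (Submodule.span ℝ (Set.range fun i ↦ ratVec (![y, rotQ y] i))) ≤ 2 := by
        have := finrank_range_le_card (R := ℝ) (fun i ↦ ratVec (![y, rotQ y] i))
        simpa [Set.finrank] using this
      omega
    obtain ⟨y', hy'0, hy'⟩ := exists_rat_mulVec_eq_zero R' hR'
    have hy'r : ∀ i, r i ⬝ᵥ y' = 0 := fun i ↦ congrFun hy' (Sum.inl i)
    have hyy' : y ⬝ᵥ y' = 0 := congrFun hy' (Sum.inr 0)
    have hAyy' : rotQ y ⬝ᵥ y' = 0 := congrFun hy' (Sum.inr 1)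
    have hUy' : ∀ x ∈ U, x ⬝ᵥ ratVec y' = 0 := fun x hx ↦ dotProduct_eq_zero_of_mem_span r hy'r hU hx
    have hUAy' : ∀ x ∈ U, x ⬝ᵥ rotLin (ratVec y') = 0 := fun x hx ↦ by
      rw [dotProduct_rotLin, hUy' _ (hA x hx), neg_zero]
    set c' := star (zetaVec (ratVec y')) with hc'def
    have hSc' : ∀ v ∈ S, v ⬝ᵥ c' = 0 := by
      rintro _ ⟨x, hx, rfl⟩
      rw [hc'def, zetaVec_dot_star, hUy' x hx, hUAy' x hx]; rfl
    set a₂ : Fin 4 → ℚ := ![y' 0, y' 2, y' 4, y' 6] with ha₂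
    set b₂ : Fin 4 → ℚ := ![-y' 1, -y' 3, -y' 5, -y' 7] with hb₂
    have hc' : c' = gaussVec a₂ b₂ := by
      funext m; fin_cases m <;> apply Complex.ext <;> simp [hc'def, zetaVec, gaussVec, ha₂, hb₂]
    have hab₂ : ¬(a₂ = 0 ∧ b₂ = 0) := by
      rintro ⟨ha, hb⟩
      apply hy'0
      funext j
      fin_cases j
      · exact congrFun ha 0
      · have e := congrFun hb 0; rw [hb₂] at e; simpa using e
      · exact congrFun ha 1
      · have e := congrFun hb 1; rw [hb₂] at e; simpa using e
      · exact congrFun ha 2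
      · have e := congrFun hb 2; rw [hb₂] at e; simpa using e
      · exact congrFun ha 3
      · have e := congrFun hb 3; rw [hb₂] at e; simpa using e
    have hc'0 : c' ≠ 0 := fun h ↦ hab₂ ((gaussVec_eq_zero_iff a₂ b₂).1 (hc' ▸ h))
    -- `c' ⊥ c` for the Hermitian pairing
    have horth : star c' ⬝ᵥ c = 0 := by
      rw [hc'def, star_star, hcdef, zetaVec_dot_star, ← ratVec_rotQ, ratVec_dotProduct,
        ratVec_dotProduct, dotProduct_comm y' y, dotProduct_comm y' (rotQ y), hyy', hAyy']
      simp [Complex.ext_iff]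
    -- `M = (· c, · c') : ℂ⁴ → ℂ²`, with the section `σ`
    set M := dotL₂ c c' with hMdef
    set n := star c ⬝ᵥ c with hn
    set n' := star c' ⬝ᵥ c' with hn'
    have hn0 : n ≠ 0 := star_dotProduct_self_ne_zero hc0
    have hn'0 : n' ≠ 0 := star_dotProduct_self_ne_zero hc'0
    have horth' : star c ⬝ᵥ c' = 0 := by rw [Matrix.star_dotProduct, horth, star_zero]
    have hMc : M (star c) = ![n, 0] := by
      rw [hMdef, dotL₂_apply, ← hn, horth']
    have hMc' : M (star c') = ![0, n'] := by
      rw [hMdef, dotL₂_apply, ← hn', horth]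
    let σ : (Fin 2 → ℂ) →ₗ[ℂ] (Fin 4 → ℂ) :=
      (LinearMap.proj 0 : (Fin 2 → ℂ) →ₗ[ℂ] ℂ).smulRight (n⁻¹ • star c) +
        (LinearMap.proj 1 : (Fin 2 → ℂ) →ₗ[ℂ] ℂ).smulRight (n'⁻¹ • star c')
    have hMσ : ∀ z, M (σ z) = z := fun z ↦ by
      simp only [σ, LinearMap.add_apply, LinearMap.smulRight_apply, LinearMap.proj_apply, map_add,
        map_smul, hMc, hMc']
      funext i
      fin_cases i
      · simp [hn0]
      · simp [hn'0]
    have hMsurj : Function.Surjective M := fun z ↦ ⟨σ z, hMσ z⟩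
    have hSleM : S ≤ LinearMap.ker M := fun v hv ↦ by
      rw [LinearMap.mem_ker, hMdef, dotL₂_apply, hSc v hv, hSc' v hv]
      funext i; fin_cases i <;> rfl
    have hkerM : finrank ℂ (LinearMap.ker M) = 2 := by
      have e1 := LinearMap.finrank_range_add_finrank_ker M
      rw [LinearMap.range_eq_top.2 hMsurj, finrank_top] at e1
      have h4 : finrank ℂ (Fin 4 → ℂ) = 4 := by simp
      have h2 : finrank ℂ (Fin 2 → ℂ) = 2 := by simp
      omega
    have hSeq : S = LinearMap.ker M := Submodule.eq_of_le_of_finrank_eq hSleM (by rw [hd, hkerM])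
    -- `F = M ∘ π_Q` kills `ker M`; the induced endomorphism `e` of `ℂ²` with `e ∘ M = F`
    set F := M ∘ₗ projQ with hFdef
    have hF : ∀ v, M v = 0 → F v = 0 := fun v hv ↦ by
      have hvS : v ∈ S := by rw [hSeq]; exact hv
      have h2 := hSQ v hvS
      rw [hSeq, LinearMap.mem_ker] at h2
      exact h2
    set e := F ∘ₗ σ with hedef
    have heM : ∀ v, e (M v) = F v := fun v ↦ by
      have e1 : M (σ (M v) - v) = 0 := by rw [map_sub, hMσ, sub_self]
      have e2 := hF _ e1
      rw [map_sub, sub_eq_zero] at e2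
      exact e2
    -- `D = M ∘ G`, `G z = z₀ h₁ + z₁ h₂`, and `e ∘ D = D`
    let G : (Fin 2 → ℂ) →ₗ[ℂ] (Fin 4 → ℂ) :=
      (LinearMap.proj 0 : (Fin 2 → ℂ) →ₗ[ℂ] ℂ).smulRight h₁ +
        (LinearMap.proj 1 : (Fin 2 → ℂ) →ₗ[ℂ] ℂ).smulRight h₂
    have hGmem : ∀ z, G z ∈ NQ := fun z ↦ by
      simp only [G, LinearMap.add_apply, LinearMap.smulRight_apply, LinearMap.proj_apply]
      exact NQ.add_mem (NQ.smul_mem _ h₁_mem) (NQ.smul_mem _ h₂_mem)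
    set D := M ∘ₗ G with hDdef
    have heD : e ∘ₗ D = D := by
      apply LinearMap.ext
      intro z
      change e (M (G z)) = M (G z)
      rw [heM]
      change M (projQ (G z)) = M (G z)
      rw [projQ_eq_self (hGmem z)]
    have hdet := congrArg (fun f ↦ (LinearMap.toMatrix' f).det) heD
    simp only [LinearMap.toMatrix'_comp, Matrix.det_mul] at hdet
    have hG0 : G (Pi.single 0 1) = h₁ := by simp [G]
    have hG1 : G (Pi.single 1 1) = h₂ := by simp [G]
    rcases eq_or_ne (LinearMap.toMatrix' D).det 0 with hD0 | hD0
    · /- the `2 × 2` determinant on `h₁, h₂` vanishes: all minors of `(c, c')` vanish (T3), so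
        `c' ∥ c`, contradicting `c' ⊥ c`, `c, c' ≠ 0`. -/
      rw [Matrix.det_fin_two] at hD0
      simp only [LinearMap.toMatrix'_apply, hDdef, LinearMap.comp_apply, hG0, hG1, hMdef,
        dotL₂_apply, Matrix.cons_val_zero, Matrix.cons_val_one] at hD0
      have hmin := minors_eq_zero_of_det_eq_zero a₁ b₁ a₂ b₂ (by
        rw [← hc, ← hc', dotProduct_comm _ h₁, dotProduct_comm _ h₂, dotProduct_comm _ h₂,
          dotProduct_comm _ h₁]
        linear_combination hD0)
      rw [← hc, ← hc'] at hmin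
      obtain ⟨j, hj⟩ : ∃ j, c j ≠ 0 := by
        by_contra h
        simp only [not_exists, not_not] at h
        exact hc0 (funext h)
      have hprop : ∀ m, c' m = (c' j / c j) * c m := fun m ↦ by
        have e1 := hmin j m
        field_simp
        linear_combination e1
      have e2 : star c' ⬝ᵥ c = star (c' j / c j) * n := by
        rw [hn]
        simp only [dotProduct, Pi.star_apply, Finset.mul_sum]
        refine Finset.sum_congr rfl fun m _ ↦ ?_
        rw [hprop m, star_mul]
        ring
      rw [horth] at e2
      have h3 := (mul_eq_zero.1 e2.symm).resolve_right hn0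
      rw [star_eq_zero, div_eq_zero_iff] at h3
      rcases h3 with h3 | h3
      · apply hc'0
        funext m
        rw [hprop m, h3, zero_div, zero_mul]
        rfl
      · exact hj h3
    · /- `det e = 1`: `e` is injective and idempotent, hence the identity; then `M ∘ π_Q = M`,
        so `c` kills `N_P = ker π_Q`: (T2b). -/
      have hE1 : (LinearMap.toMatrix' e).det = 1 := by
        have e1 : ((LinearMap.toMatrix' e).det - 1) * (LinearMap.toMatrix' D).det = 0 := by
          linear_combination hdet
        rcases mul_eq_zero.1 e1 with h | h
        · exact sub_eq_zero.1 h
        · exact absurd h hD0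
      have hinj : Function.Injective e := by
        have hU : IsUnit (LinearMap.toMatrix' e) :=
          (Matrix.isUnit_iff_isUnit_det _).2 (by rw [hE1]; exact isUnit_one)
        have hmi := Matrix.mulVec_injective_iff_isUnit.2 hU
        intro z w hzw
        apply hmi
        change LinearMap.toMatrix' e *ᵥ z = LinearMap.toMatrix' e *ᵥ w
        rw [LinearMap.toMatrix'_mulVec, LinearMap.toMatrix'_mulVec]
        exact hzw
      have hee : ∀ z, e (e z) = e z := fun z ↦ by
        obtain ⟨w, rfl⟩ := hMsurj z
        rw [heM]
        change e (M (projQ w)) = F w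
        rw [heM]
        change M (projQ (projQ w)) = M (projQ w)
        rw [projQ_eq_self (projQ_mem w)]
      have hid : ∀ z, e z = z := fun z ↦ by
        have e1 : e (e z - z) = e 0 := by rw [map_sub, hee, sub_self, map_zero]
        exact sub_eq_zero.1 (hinj e1)
      have hFM : ∀ v, F v = M v := fun v ↦ by rw [← heM, hid]
      apply T2b
      have e1 := hFM g₁
      have e2 := hFM g₂
      rw [hFdef, LinearMap.comp_apply, projQ_eq_zero g₁_mem, map_zero] at e1
      rw [hFdef, LinearMap.comp_apply, projQ_eq_zero g₂_mem, map_zero] at e2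
      rw [hMdef, dotL₂_apply] at e1 e2
      exact ⟨(congrFun e1 0).symm, (congrFun e2 0).symm⟩
  · /- d = 3 : `S = ker (· c)` and the induced idempotent on `ℂ⁴/S ≅ ℂ` is `0` or `1`, so `c`
      kills `N_Q` or `N_P`: (T2). -/
    set f := dotL c with hf
    have hSle : S ≤ LinearMap.ker f := fun v hv ↦ LinearMap.mem_ker.2 (hSc v hv)
    have hfc : f (star c) ≠ 0 := star_dotProduct_self_ne_zero hc0
    have hsurj : Function.Surjective f := fun z ↦
      ⟨(z / f (star c)) • star c, by rw [map_smul, smul_eq_mul, div_mul_cancel₀ _ hfc]⟩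
    have hker : finrank ℂ (LinearMap.ker f) = 3 := by
      have e1 := LinearMap.finrank_range_add_finrank_ker f
      rw [LinearMap.range_eq_top.2 hsurj, finrank_top, Module.finrank_self] at e1
      have h4 : finrank ℂ (Fin 4 → ℂ) = 4 := by simp
      omega
    have hSeq : S = LinearMap.ker f :=
      Submodule.eq_of_le_of_finrank_eq hSle (by rw [hd, hker])
    have hkerQ : ∀ v, f v = 0 → f (projQ v) = 0 := fun v hv ↦ by
      have hvS : v ∈ S := by rw [hSeq]; exact hv
      have h2 := hSQ v hvS
      rw [hSeq] at h2
      exact h2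
    set v₀ := (f (star c))⁻¹ • star c with hv₀
    have hfv₀ : f v₀ = 1 := by rw [hv₀, map_smul, smul_eq_mul, inv_mul_cancel₀ hfc]
    set l := f (projQ v₀) with hl
    have hformula : ∀ v, f (projQ v) = f v * l := fun v ↦ by
      have e1 : f (v - f v • v₀) = 0 := by
        rw [map_sub, map_smul, smul_eq_mul, hfv₀, mul_one, sub_self]
      have e2 := hkerQ _ e1
      rw [map_sub, map_smul, map_sub, map_smul, smul_eq_mul] at e2
      exact sub_eq_zero.1 e2
    have hl2 : l = l * l := by
      have e1 := hformula (projQ v₀)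
      rwa [projQ_eq_self (projQ_mem _)] at e1
    have hl01 : l = 0 ∨ l = 1 := by
      have e1 : l * (1 - l) = 0 := by linear_combination hl2
      rcases mul_eq_zero.1 e1 with h | h
      · exact Or.inl h
      · exact Or.inr (by linear_combination -h)
    rcases hl01 with h | h
    · apply T2a
      constructor
      · have e1 := hformula h₁
        rw [projQ_eq_self h₁_mem, h, mul_zero] at e1
        exact e1
      · have e1 := hformula h₂
        rw [projQ_eq_self h₂_mem, h, mul_zero] at e1
        exact e1
    · apply T2b
      constructor
      · have e1 := hformula g₁
        rw [projQ_eq_zero g₁_mem, map_zero, h, mul_one] at e1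
        exact e1.symm
      · have e1 := hformula g₂
        rw [projQ_eq_zero g₂_mem, map_zero, h, mul_one] at e1
        exact e1.symm

/-! ### Case 2: `Γ_ℝ = V ⊕ A V` -/

/-- **Case 2 of the simplicity proof.** There is no non-zero real subspace `V` of `Γ_ℝ` spanned by
rational vectors, stable under `I_t`, with `Γ_ℝ = V ⊕ A V`: the projection `π` onto `V` along
`A V` is rational and commutes with `I_t`, and `π - ½` anticommutes with `A`, so `π = ½` by
Part B (`eq_zero_of_anticommute`), which is not idempotent. [cite: Voisin2002KaehlerCounterexample, §3 Prop. 3 (ii)] -/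
theorem not_isCompl_map_rotLin {ι : Type*} [Fintype ι] (r : ι → Fin 8 → ℚ)
    (V : Submodule ℝ (Fin 8 → ℝ)) (hV : V = Submodule.span ℝ (Set.range fun i ↦ ratVec (r i)))
    (hcs : ∀ x ∈ V, cs x ∈ V) (hc : IsCompl V (V.map rotLin)) (h0 : V ≠ ⊥) : False := by
  classical
  have hAV : V.map rotLin = Submodule.span ℝ (Set.range fun i ↦ ratVec (rotQ (r i))) := by
    rw [hV, map_rotLin_span]
  -- `A` maps `A V` back into `V`, `I_t` preserves `A V`
  have hAA : ∀ x ∈ V.map rotLin, rotLin x ∈ V := by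
    rintro _ ⟨v, hv, rfl⟩
    rw [rotLin_rotLin]; exact V.neg_mem hv
  have hAVcs : ∀ x ∈ V.map rotLin, cs x ∈ V.map rotLin := by
    rintro _ ⟨v, hv, rfl⟩
    exact ⟨cs v, hcs v hv, (cs_rotLin v).symm⟩
  -- the rational structure: `ℚ⁸ = V_ℚ ⊕ (A V)_ℚ`
  set Vq := Submodule.span ℚ (Set.range r) with hVq
  set AVq := Submodule.span ℚ (Set.range fun i ↦ rotQ (r i)) with hAVq
  have hratV : ∀ q ∈ Vq, ratVec q ∈ V := fun q hq ↦ by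
    rw [hV]; exact ratVec_mem_span_of_mem_span r hq
  have hratAV : ∀ q ∈ AVq, ratVec q ∈ V.map rotLin := fun q hq ↦ by
    rw [hAV]; exact ratVec_mem_span_of_mem_span (fun i ↦ rotQ (r i)) hq
  have hq : IsCompl Vq AVq := by
    have hdis : Disjoint Vq AVq := by
      rw [Submodule.disjoint_def]
      intro q h1 h2
      have : ratVec q ∈ V ⊓ V.map rotLin := ⟨hratV q h1, hratAV q h2⟩
      rw [hc.inf_eq_bot, Submodule.mem_bot] at this
      exact ratVec_eq_zero_iff.1 this
    refine IsCompl.of_eq hdis.eq_bot ?_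
    apply Submodule.eq_top_of_finrank_eq
    have e1 := Submodule.finrank_sup_add_finrank_inf_eq Vq AVq
    rw [hdis.eq_bot, finrank_bot, add_zero] at e1
    have e2 := Submodule.finrank_sup_add_finrank_inf_eq V (V.map rotLin)
    rw [hc.sup_eq_top, hc.inf_eq_bot, finrank_bot, add_zero, finrank_top, hAV] at e2
    conv at e2 => rhs; rw [hV]
    rw [finrank_span_ratVec, finrank_span_ratVec] at e2
    have e3 : finrank ℚ Vq + finrank ℚ AVq = 8 := by
      have h8 : finrank ℝ (Fin 8 → ℝ) = 8 := by simp
      rw [h8] at e2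
      exact e2.symm
    have h8' : finrank ℚ (Fin 8 → ℚ) = 8 := by simp
    rw [h8']
    omega
  -- the two projections
  set πq := Vq.projection AVq hq with hπq
  set π := V.projection (V.map rotLin) hc with hπ
  have hππ : ∀ q, π (ratVec q) = ratVec (πq q) := fun q ↦ by
    have e1 : q = πq q + (AVq.projection Vq hq.symm) q :=
      (Submodule.projection_add_projection_eq_self hq q).symm
    have e2 : ratVec q = ratVec (πq q) + ratVec ((AVq.projection Vq hq.symm) q) := by
      conv_lhs => rw [e1]
      exact map_add ratVecₗ _ _
    rw [e2, map_add, (Submodule.projection_eq_self_iff hc _).2 (hratV _ (Submodule.projection_apply_mem hq q)),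
      (Submodule.projection_apply_eq_zero_iff hc).2 (hratAV _ (Submodule.projection_apply_mem hq.symm q)),
      add_zero]
  have hπA : ∀ x, π (rotLin x) = rotLin x - rotLin (π x) := fun x ↦ by
    have e1 : x = π x + (x - π x) := by abel
    have hπx : π x ∈ V := Submodule.projection_apply_mem hc x
    have hx' : x - π x ∈ V.map rotLin := by
      rw [← Submodule.projection_eq_self_sub_projection hc]
      exact Submodule.projection_apply_mem hc.symm x
    have e2 : rotLin x = rotLin (x - π x) + rotLin (π x) := by rw [map_sub]; abel
    rw [e2, map_add, (Submodule.projection_eq_self_iff hc _).2 (hAA _ hx'),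
      (Submodule.projection_apply_eq_zero_iff hc).2 ⟨π x, hπx, rfl⟩, add_zero, map_sub]
    abel
  have hπcs : ∀ x, π (cs x) = cs (π x) := fun x ↦ by
    have hπx : π x ∈ V := Submodule.projection_apply_mem hc x
    have hx' : x - π x ∈ V.map rotLin := by
      rw [← Submodule.projection_eq_self_sub_projection hc]
      exact Submodule.projection_apply_mem hc.symm x
    have e2 : cs x = cs (π x) + cs (x - π x) := by rw [map_sub]; abel
    rw [e2, map_add, (Submodule.projection_eq_self_iff hc _).2 (hcs _ hπx),
      (Submodule.projection_apply_eq_zero_iff hc).2 (hAVcs _ hx'), add_zero]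
  -- `L = π - ½` is rational, anticommutes with `A`, commutes with `I_t`: hence `L = 0`
  set L := π - (1 / 2 : ℝ) • LinearMap.id with hL
  have hL0 : L = 0 := by
    refine eq_zero_of_anticommute L (fun x ↦ ?_) (fun j ↦ ?_) (fun x ↦ ?_)
    · simp only [hL, LinearMap.sub_apply, LinearMap.smul_apply, LinearMap.id_apply, hπA, map_sub,
        map_smul, neg_sub]
      module
    · refine ⟨πq (Pi.single j 1) - (1 / 2 : ℚ) • Pi.single j 1, ?_⟩
      simp only [hL, LinearMap.sub_apply, LinearMap.smul_apply, LinearMap.id_apply]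
      rw [← ratVec_single, hππ]
      funext l
      simp only [Pi.sub_apply, Pi.smul_apply, ratVec_apply, smul_eq_mul]
      push_cast
      ring
    · simp only [hL, LinearMap.sub_apply, LinearMap.smul_apply, LinearMap.id_apply, hπcs, map_sub,
        map_smul]
  -- `π = ½` is not a projection onto `V ≠ 0`
  obtain ⟨v, hv, hv0⟩ := Submodule.exists_mem_ne_zero_of_ne_bot h0
  have e1 : π v = v := (Submodule.projection_eq_self_iff hc _).2 hv
  have e2 : L v = 0 := by rw [hL0]; rfl
  simp only [hL, LinearMap.sub_apply, LinearMap.smul_apply, LinearMap.id_apply, e1] at e2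
  apply hv0
  have e3 : v = (2 : ℝ) • (v - (1 / 2 : ℝ) • v) := by module
  rw [e3, e2, smul_zero]

/-! ### Simplicity -/

/-- **The explicit complex torus of Weil type is simple** (Voisin (2002), Prop. 3 (ii): "`X` is
simple" for the general member of the family; here for the one explicit very general member
`X = ℂ⁴/Φ(ℤ⁸)`, `Φ = Weil.periodEquiv`): a real subspace `V` of `Γ_ℝ = ℝ⁸` which is spanned by
rational (lattice) vectors — so that `V/(V ∩ Γ)` is a real subtorus — and which is stable under the
complex structure `I_t = Φ⁻¹ ∘ i ∘ Φ` — so that `Φ(V)` is a complex subspace and the subtorus a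
complex subtorus — is `0` or everything. Proof: `V ∩ A V` and `V + A V` are again rational and
`I_t`-stable, and moreover `A`-stable; if one of them is proper and non-zero, Case 1
(`not_stable_of_rotLin_stable`) applies; otherwise `Γ_ℝ = V ⊕ A V` and Case 2
(`not_isCompl_map_rotLin`) applies. [cite: Voisin2002KaehlerCounterexample, §3 Prop. 3 (ii)] -/
theorem eq_bot_or_eq_top_of_cs_stable {ι : Type*} [Fintype ι] (r : ι → Fin 8 → ℚ)
    (V : Submodule ℝ (Fin 8 → ℝ)) (hV : V = Submodule.span ℝ (Set.range fun i ↦ ratVec (r i)))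
    (hcs : ∀ x ∈ V, cs x ∈ V) : V = ⊥ ∨ V = ⊤ := by
  classical
  by_contra h
  rw [not_or] at h
  obtain ⟨h0, h1⟩ := h
  have hAV : V.map rotLin = Submodule.span ℝ (Set.range fun i ↦ ratVec (rotQ (r i))) := by
    rw [hV, map_rotLin_span]
  have hAA : ∀ x ∈ V.map rotLin, rotLin x ∈ V := by
    rintro _ ⟨v, hv, rfl⟩
    rw [rotLin_rotLin]; exact V.neg_mem hv
  have hAVcs : ∀ x ∈ V.map rotLin, cs x ∈ V.map rotLin := by
    rintro _ ⟨v, hv, rfl⟩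
    exact ⟨cs v, hcs v hv, (cs_rotLin v).symm⟩
  by_cases hinf : V ⊓ V.map rotLin = ⊥
  · by_cases hsup : V ⊔ V.map rotLin = ⊤
    · exact not_isCompl_map_rotLin r V hV hcs (IsCompl.of_eq hinf hsup) h0
    · -- Case 1 with `U = V + A V`
      refine not_stable_of_rotLin_stable (Sum.elim r fun i ↦ rotQ (r i)) (V ⊔ V.map rotLin)
        (by rw [span_ratVec_sum, ← hV, ← hAV]) ?_ ?_ ?_ hsup
      · intro x hx
        obtain ⟨v, hv, w, hw, rfl⟩ := Submodule.mem_sup.1 hx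
        rw [map_add]
        exact Submodule.add_mem _ (Submodule.mem_sup_right ⟨v, hv, rfl⟩)
          (Submodule.mem_sup_left (hAA w hw))
      · intro x hx
        obtain ⟨v, hv, w, hw, rfl⟩ := Submodule.mem_sup.1 hx
        rw [map_add]
        exact Submodule.add_mem _ (Submodule.mem_sup_left (hcs v hv))
          (Submodule.mem_sup_right (hAVcs w hw))
      · exact fun h ↦ h0 (eq_bot_iff.2 (h ▸ le_sup_left))
  · -- Case 1 with `U = V ∩ A V`
    obtain ⟨k, r', hr'⟩ := exists_span_ratVec_eq_inf r (fun i ↦ rotQ (r i))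
    rw [← hV, ← hAV] at hr'
    refine not_stable_of_rotLin_stable r' (V ⊓ V.map rotLin) hr'.symm ?_ ?_ hinf ?_
    · intro x hx
      exact ⟨hAA x hx.2, ⟨x, hx.1, rfl⟩⟩
    · intro x hx
      exact ⟨hcs x hx.1, hAVcs x hx.2⟩
    · exact fun h ↦ h1 (eq_top_iff.2 (h ▸ inf_le_left))

/-- **Simplicity, lattice form.** The same for a real subspace spanned by an arbitrary set of
LATTICE vectors (`ℤ⁸ = Γ`): a finite spanning subfamily exists since `Γ_ℝ` is Noetherian, and
integer vectors are rational. This is the form "`X` has no complex subtorus `≠ 0, X`"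
(Lange–Birkenhake (1992), Exercise 1.1.6 (2)(a): complex subtori of `V/Λ` correspond to subgroups
`Λ' ⊆ Λ` with `Λ' ⊗ ℝ` a complex subspace). [cite: Voisin2002KaehlerCounterexample, §3 Prop. 3 (ii)] -/
theorem eq_bot_or_eq_top_of_cs_stable_of_span_int (V : Submodule ℝ (Fin 8 → ℝ)) (S : Set (Fin 8 → ℤ))
    (hV : V = Submodule.span ℝ ((fun m i ↦ (m i : ℝ)) '' S)) (hcs : ∀ x ∈ V, cs x ∈ V) :
    V = ⊥ ∨ V = ⊤ := by
  classical
  have hfg : (Submodule.span ℝ ((fun (m : Fin 8 → ℤ) (i : Fin 8) ↦ (m i : ℝ)) '' S)).FG :=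
    IsNoetherian.noetherian _
  obtain ⟨t, ht, hspan⟩ := (Submodule.fg_span_iff_fg_span_finset_subset _).1 hfg
  have hm : ∀ x ∈ t, ∃ m ∈ S, (fun i ↦ (m i : ℝ)) = x := fun x hx ↦ ht hx
  choose! m hmS hm using hm
  refine eq_bot_or_eq_top_of_cs_stable (ι := t) (fun x ↦ fun i ↦ (m x i : ℚ)) V ?_ hcs
  rw [hV, hspan]
  congr 1
  ext y
  simp only [Finset.mem_coe, Set.mem_range]
  constructor
  · intro hy
    refine ⟨⟨y, hy⟩, ?_⟩
    conv_rhs => rw [← hm y hy]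
    funext i
    simp
  · rintro ⟨x, rfl⟩
    have e : ratVec (fun i ↦ (m x i : ℚ)) = fun i ↦ (m x i : ℝ) := by funext i; simp
    rw [e, hm x x.2]
    exact x.2

end Weil

end Literature.Geometry.Kaehler

end
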